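import Summits.CriticalPhenomena.PercolationContinuityZ3.Theorems.PercNearOneGluingNoHeavyQuantDECAtTMixtures
import HarnessLib

/-!
# QUANT lane R8, T-DEC: HEAVY (layer-free) decompositions at a target, and the UPWARD-SHIFT lemmas — moving any part of a
# law's mass up by `r` keeps a heavy decomposition; shifting the whole law by `s` raises the target by `2s`
# (prim-quant-census-2 gen 80)

builds on p205010 (kernel theorem, internal audit signed; external expert review pending)

Support file (`--supports stmt-CriticalPhenomena-4575`), QUANT lane census seat prim-quant-census-2 (gen 80); memo
`run/shared/lean/prim/quant/prim-quant-census-2-g80/TRIPLE-G80.md` §2.  Theorems only, standard axioms, no sorries, no definitions.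

A HEAVY DECOMPOSITION of a law `μ` on `{0..M}` at floor `x` and target `T` is an exact finite mixture of two-point components
`{lo, hi; γ}` (`lo ≤ hi ≤ M`) with `x ≤ γ` and credit `2·lo + (hi − lo)·γ ≥ T` for every charged component (a point is `lo = hi`, then
the condition reads `T ≤ 2·lo`).  It is written inline as an `∃` (no new definition).  Such a decomposition is valid at EVERY layer:
a pair is giant-valid above the layer (`γ ≥ x`) and credit-valid below it (`κ_x(γ) = γ`), a point is self-sufficient —
**`decAtT_of_heavy`**.  The two bookkeeping moves of this file:
* **`heavy_shift_full`** — shifting the whole law up by `s` gives a heavy decomposition at target `T + 2s` (every credit gains `2s`);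
* **`heavy_shift_partial`** — for ANY splitting `μ = μ₁ + μ₂` into nonnegative parts, the law `μ₁ + (μ₂ shifted up by r)` keeps a heavy
  decomposition at the SAME `(x, T)`: each component is split according to the moved fractions `θ_lo`, `θ_hi` of its two atoms; the piece
  whose low end moves past its high end (`lo + r > hi`) becomes two self-sufficient points (`2·hi ≥ lo + hi ≥ T`).
USE (census-2 g80, `…QuantBlobAverageFloor`, `…QuantGluedTripleTrueFloor`): the law of three equal blobs is heavy at its AVERAGE gate; the
glued sibling's sure relays are then inserted by a partial shift (the gated copy) and a full shift (the two sure copies) — the lift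
`ρ ∗ ρ ∗ gate_c ρ` DEC at floor `(2+c)g/3`, every shape, which closes the identical glued triple at its true floor.

HONEST STATUS.  Tools; `SiblingStep`, `FarTreeRow` OPEN; RATE class (log\*) / honest sentence of `run/shared/lean/prim/quant/README.md`
unchanged.  [this work].  Nothing here is cited as a published result.  The gluing rows served [cite: KozmaNitzan2024, Conjecture 3 (p. 15)];
product measure [cite: Grimmett1999, §1.3 p. 10].
-/

noncomputable section

open scoped BigOperators

namespace Summit.CriticalPhenomena.PercolationContinuityZ3.Theorems
namespace Quant

open Finset

/-- the two-point law `{lo, hi; g}` (as in `…QuantLawDEC`) -/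
local notation3 "TP[" lo ", " hi ", " g ", " h "]" =>
  (g : ℝ) * (if (h : ℕ) = (hi : ℕ) then (1 : ℝ) else 0) + (1 - (g : ℝ)) * (if (h : ℕ) = (lo : ℕ) then (1 : ℝ) else 0)

namespace LawDec

/-! ### Heavy decompositions are valid at every layer -/

/-- **A HEAVY DECOMPOSITION IS DEC AT EVERY LAYER.**  If `μ` on `{0..M}` is an exact mixture of components `{lo, hi; γ}` with `x ≤ γ` and
`T ≤ 2·lo + (hi − lo)·γ` (charged components), then `DECAtT x T j M μ` for every layer `j`: a point (`lo = hi`) is self-sufficient, a pair is a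
giant pair when `hi ≥ j+1` and a heavy credit pair (`κ_x(γ) = γ`) when `hi ≤ j`. [this work] -/
theorem decAtT_of_heavy (x T : ℝ) (M : ℕ) (μ : ℕ → ℝ)
    (hH : ∃ (ι : Type) (_ : Fintype ι) (lam γ : ι → ℝ) (lo hi : ι → ℕ),
      (∀ i, 0 ≤ lam i) ∧ (∑ i, lam i = 1) ∧ (∀ i, 0 ≤ γ i ∧ γ i ≤ 1) ∧ (∀ i, lo i ≤ hi i) ∧ (∀ i, hi i ≤ M) ∧
      (∀ h, μ h = ∑ i, lam i * TP[lo i, hi i, γ i, h]) ∧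
      (∀ i, 0 < lam i → x ≤ γ i ∧ T ≤ 2 * (lo i : ℝ) + ((hi i : ℝ) - lo i) * γ i))
    (j : ℕ) : DECAtT x T j M μ := by
  obtain ⟨ι, hι, lam, γ, lo, hi, h0, h1, hγ, hlohi, hhi, hμ, hval⟩ := hH
  refine ⟨ι, hι, lam, γ, lo, hi, h0, h1, hγ, hlohi, hhi, hμ, fun i hi0 => ?_⟩
  obtain ⟨hxγ, hcr⟩ := hval i hi0
  rcases (hlohi i).eq_or_lt with heq | hlt
  · refine Or.inl ⟨heq, Or.inl ?_⟩
    rw [heq, sub_self, zero_mul, add_zero] at hcr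
    rw [heq]; exact hcr
  · by_cases hj : j + 1 ≤ hi i
    · exact Or.inr (Or.inl ⟨hlt, hj, hxγ⟩)
    · refine Or.inr (Or.inr ⟨hlt, by omega, ?_⟩)
      rw [if_pos hxγ]; exact hcr

/-! ### Full shift: the target rises by twice the shift -/

/-- **FULL SHIFT.**  A heavy decomposition of `μ` at `(x, T)` on `{0..M}` gives one of `h ↦ μ(h − s)·[s ≤ h]` at `(x, T + 2s)` on
`{0..M+s}` (every component moves up by `s`; its credit gains `2s`). [this work] -/
theorem heavy_shift_full (x T : ℝ) (M s : ℕ) (μ : ℕ → ℝ)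
    (hH : ∃ (ι : Type) (_ : Fintype ι) (lam γ : ι → ℝ) (lo hi : ι → ℕ),
      (∀ i, 0 ≤ lam i) ∧ (∑ i, lam i = 1) ∧ (∀ i, 0 ≤ γ i ∧ γ i ≤ 1) ∧ (∀ i, lo i ≤ hi i) ∧ (∀ i, hi i ≤ M) ∧
      (∀ h, μ h = ∑ i, lam i * TP[lo i, hi i, γ i, h]) ∧
      (∀ i, 0 < lam i → x ≤ γ i ∧ T ≤ 2 * (lo i : ℝ) + ((hi i : ℝ) - lo i) * γ i)) :
    ∃ (ι : Type) (_ : Fintype ι) (lam γ : ι → ℝ) (lo hi : ι → ℕ),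
      (∀ i, 0 ≤ lam i) ∧ (∑ i, lam i = 1) ∧ (∀ i, 0 ≤ γ i ∧ γ i ≤ 1) ∧ (∀ i, lo i ≤ hi i) ∧ (∀ i, hi i ≤ M + s) ∧
      (∀ h, (if s ≤ h then μ (h - s) else 0) = ∑ i, lam i * TP[lo i, hi i, γ i, h]) ∧
      (∀ i, 0 < lam i → x ≤ γ i ∧ T + 2 * (s : ℝ) ≤ 2 * (lo i : ℝ) + ((hi i : ℝ) - lo i) * γ i) := by
  obtain ⟨ι, hι, lam, γ, lo, hi, h0, h1, hγ, hlohi, hhi, hμ, hval⟩ := hH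
  refine ⟨ι, hι, lam, γ, fun i => lo i + s, fun i => hi i + s, h0, h1, hγ, fun i => by simpa using hlohi i,
    fun i => by simpa using hhi i, fun h => ?_, fun i hi0 => ?_⟩
  · by_cases hs : s ≤ h
    · rw [if_pos hs, hμ (h - s)]
      refine Finset.sum_congr rfl fun i _ => ?_
      have e1 : (if h - s = hi i then (1 : ℝ) else 0) = (if h = hi i + s then 1 else 0) := by
        by_cases hc : h - s = hi i
        · rw [if_pos hc, if_pos (by omega)]
        · rw [if_neg hc, if_neg (by omega)]
      have e2 : (if h - s = lo i then (1 : ℝ) else 0) = (if h = lo i + s then 1 else 0) := by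
        by_cases hc : h - s = lo i
        · rw [if_pos hc, if_pos (by omega)]
        · rw [if_neg hc, if_neg (by omega)]
      rw [e1, e2]
    · rw [if_neg hs]
      symm
      refine Finset.sum_eq_zero fun i _ => ?_
      have e1 : ¬ (h = hi i + s) := by omega
      have e2 : ¬ (h = lo i + s) := by omega
      simp only [e1, e2, if_false, mul_zero, add_zero]
  · obtain ⟨hxγ, hcr⟩ := hval i hi0
    refine ⟨hxγ, ?_⟩
    push_cast
    nlinarith [(hγ i).2]

/-! ### Partial shift: any part of the mass may move up, at the same target -/

/-- indicator algebra: `f h · [h = a] = f a · [h = a]`. -/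
theorem mul_indicator_eq (f : ℕ → ℝ) (h a : ℕ) :
    f h * (if h = a then (1 : ℝ) else 0) = f a * (if h = a then (1 : ℝ) else 0) := by
  by_cases e : h = a
  · rw [e]
  · rw [if_neg e, mul_zero, mul_zero]

/-- **PARTIAL UPWARD SHIFT.**  Let `μ = μ₁ + μ₂` with `μ₁, μ₂ ≥ 0`, and let `μ` carry a heavy decomposition at `(x, T)` on `{0..M}` (`x ≤ 1`).
Then the law `h ↦ μ₁ h + μ₂(h − r)·[r ≤ h]` (the part `μ₂` moved up by `r`) carries a heavy decomposition at the same `(x, T)` on `{0..M+r}`.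
Each component `{lo, hi; γ}` of weight `λ` splits by the moved fractions `θ_lo`, `θ_hi` of its two atoms into `{lo, hi}`, `{lo, hi+r}`,
`{lo+r, hi+r}` and `{lo+r, hi}` — the last one read as the two self-sufficient points `lo+r`, `hi` when `lo + r > hi`
(`2(lo+r) > 2hi ≥ lo + hi ≥ T`); credits only grow. [this work] -/
theorem heavy_shift_partial (x T : ℝ) (M r : ℕ) (μ μ₁ μ₂ : ℕ → ℝ) (hx1 : x ≤ 1)
    (hμ : ∀ h, μ h = μ₁ h + μ₂ h) (h10 : ∀ h, 0 ≤ μ₁ h) (h20 : ∀ h, 0 ≤ μ₂ h)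
    (hH : ∃ (ι : Type) (_ : Fintype ι) (lam γ : ι → ℝ) (lo hi : ι → ℕ),
      (∀ i, 0 ≤ lam i) ∧ (∑ i, lam i = 1) ∧ (∀ i, 0 ≤ γ i ∧ γ i ≤ 1) ∧ (∀ i, lo i ≤ hi i) ∧ (∀ i, hi i ≤ M) ∧
      (∀ h, μ h = ∑ i, lam i * TP[lo i, hi i, γ i, h]) ∧
      (∀ i, 0 < lam i → x ≤ γ i ∧ T ≤ 2 * (lo i : ℝ) + ((hi i : ℝ) - lo i) * γ i)) :
    ∃ (ι : Type) (_ : Fintype ι) (lam γ : ι → ℝ) (lo hi : ι → ℕ),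
      (∀ i, 0 ≤ lam i) ∧ (∑ i, lam i = 1) ∧ (∀ i, 0 ≤ γ i ∧ γ i ≤ 1) ∧ (∀ i, lo i ≤ hi i) ∧ (∀ i, hi i ≤ M + r) ∧
      (∀ h, (μ₁ h + (if r ≤ h then μ₂ (h - r) else 0)) = ∑ i, lam i * TP[lo i, hi i, γ i, h]) ∧
      (∀ i, 0 < lam i → x ≤ γ i ∧ T ≤ 2 * (lo i : ℝ) + ((hi i : ℝ) - lo i) * γ i) := by
  classical
  obtain ⟨ι, hι, lam, γ, lo, hi, h0, h1, hγ, hlohi, hhi, hlaw, hval⟩ := hH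
  have hμ0 : ∀ h, 0 ≤ μ h := fun h => by rw [hμ h]; exact add_nonneg (h10 h) (h20 h)
  -- the moved fraction at each atom
  set θ : ℕ → ℝ := fun h => if μ h = 0 then 0 else μ₂ h / μ h with hθdef
  have hθ0 : ∀ h, 0 ≤ θ h := fun h => by
    simp only [hθdef]; split_ifs
    · exact le_rfl
    · exact div_nonneg (h20 h) (hμ0 h)
  have hθ1 : ∀ h, θ h ≤ 1 := fun h => by
    simp only [hθdef]; split_ifs with hz
    · exact zero_le_one
    · rw [div_le_one (lt_of_le_of_ne (hμ0 h) (Ne.symm hz))]; linarith [hμ h, h10 h]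
  have hθA : ∀ h, (1 - θ h) * μ h = μ₁ h := fun h => by
    simp only [hθdef]; split_ifs with hz
    · have : μ₁ h = 0 := by linarith [h10 h, h20 h, hμ h]
      rw [hz, this]; ring
    · field_simp; linarith [hμ h]
  have hθB : ∀ h, θ h * μ h = μ₂ h := fun h => by
    simp only [hθdef]; split_ifs with hz
    · have : μ₂ h = 0 := by linarith [h10 h, h20 h, hμ h]
      rw [this]; ring
    · field_simp
  -- weights of the four pieces of a component
  set wAA : ι → ℝ := fun i => lam i * (1 - θ (lo i)) * (1 - θ (hi i)) with hwAA
  set wAB : ι → ℝ := fun i => lam i * (1 - θ (lo i)) * θ (hi i) with hwAB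
  set wBA : ι → ℝ := fun i => lam i * θ (lo i) * (1 - θ (hi i)) with hwBA
  set wBB : ι → ℝ := fun i => lam i * θ (lo i) * θ (hi i) with hwBB
  have hwAA0 : ∀ i, 0 ≤ wAA i := fun i => mul_nonneg (mul_nonneg (h0 i) (by linarith [hθ1 (lo i)])) (by linarith [hθ1 (hi i)])
  have hwAB0 : ∀ i, 0 ≤ wAB i := fun i => mul_nonneg (mul_nonneg (h0 i) (by linarith [hθ1 (lo i)])) (hθ0 (hi i))
  have hwBA0 : ∀ i, 0 ≤ wBA i := fun i => mul_nonneg (mul_nonneg (h0 i) (hθ0 (lo i))) (by linarith [hθ1 (hi i)])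
  have hwBB0 : ∀ i, 0 ≤ wBB i := fun i => mul_nonneg (mul_nonneg (h0 i) (hθ0 (lo i))) (hθ0 (hi i))
  -- a charged piece comes from a charged component
  have hpos : ∀ i, ∀ a b : ℝ, 0 ≤ a → a ≤ 1 → 0 ≤ b → b ≤ 1 → 0 < lam i * a * b → 0 < lam i := by
    intro i a b ha0 ha1 hb0 hb1 hp
    rcases (h0 i).eq_or_lt with hz | hz
    · rw [← hz, zero_mul, zero_mul] at hp; exact absurd hp (lt_irrefl 0)
    · exact hz
  -- the new components, indexed by `ι × Fin 5`: AA, AB, BB, BA (pair, or its low point), BA (its high point)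
  refine ⟨ι × Fin 5, inferInstance,
    fun p => ![wAA p.1, wAB p.1, wBB p.1,
      (if lo p.1 + r ≤ hi p.1 then wBA p.1 else wBA p.1 * (1 - γ p.1)),
      (if lo p.1 + r ≤ hi p.1 then 0 else wBA p.1 * γ p.1)] p.2,
    fun p => ![γ p.1, γ p.1, γ p.1, (if lo p.1 + r ≤ hi p.1 then γ p.1 else 1), 1] p.2,
    fun p => ![lo p.1, lo p.1, lo p.1 + r, lo p.1 + r, hi p.1] p.2,
    fun p => ![hi p.1, hi p.1 + r, hi p.1 + r, (if lo p.1 + r ≤ hi p.1 then hi p.1 else lo p.1 + r), hi p.1] p.2,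
    ?_, ?_, ?_, ?_, ?_, fun h => ?_, ?_⟩
  · -- nonnegative weights
    rintro ⟨i, k⟩
    fin_cases k
    · exact hwAA0 i
    · exact hwAB0 i
    · exact hwBB0 i
    · show 0 ≤ (if lo i + r ≤ hi i then wBA i else wBA i * (1 - γ i))
      split_ifs
      · exact hwBA0 i
      · exact mul_nonneg (hwBA0 i) (by linarith [(hγ i).2])
    · show 0 ≤ (if lo i + r ≤ hi i then (0 : ℝ) else wBA i * γ i)
      split_ifs
      · exact le_rfl
      · exact mul_nonneg (hwBA0 i) (hγ i).1
  · -- total weight one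
    rw [Fintype.sum_prod_type]
    have e : ∀ i, ∑ k : Fin 5, (![wAA i, wAB i, wBB i,
        (if lo i + r ≤ hi i then wBA i else wBA i * (1 - γ i)),
        (if lo i + r ≤ hi i then 0 else wBA i * γ i)] : Fin 5 → ℝ) k = lam i := by
      intro i
      rw [Fin.sum_univ_five]
      simp only [Matrix.cons_val_zero, Matrix.cons_val_one, Matrix.head_cons, Matrix.cons_val_two, Matrix.tail_cons,
        Matrix.cons_val_three, Matrix.cons_val_four]
      split_ifs <;> · simp only [hwAA, hwAB, hwBB, hwBA]; ring
    simp_rw [e]; exact h1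
  · -- gates in [0,1]
    rintro ⟨i, k⟩
    fin_cases k
    · exact hγ i
    · exact hγ i
    · exact hγ i
    · show 0 ≤ (if lo i + r ≤ hi i then γ i else 1) ∧ (if lo i + r ≤ hi i then γ i else 1) ≤ 1
      split_ifs
      · exact hγ i
      · exact ⟨zero_le_one, le_rfl⟩
    · exact ⟨zero_le_one, le_rfl⟩
  · -- lo ≤ hi
    rintro ⟨i, k⟩
    fin_cases k
    · exact hlohi i
    · show lo i ≤ hi i + r
      exact (hlohi i).trans (Nat.le_add_right _ _)
    · show lo i + r ≤ hi i + r
      exact Nat.add_le_add_right (hlohi i) r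
    · show lo i + r ≤ (if lo i + r ≤ hi i then hi i else lo i + r)
      split_ifs with hc
      · exact hc
      · exact le_rfl
    · exact le_rfl
  · -- hi ≤ M + r
    rintro ⟨i, k⟩
    fin_cases k
    · exact (hhi i).trans (Nat.le_add_right _ _)
    · exact Nat.add_le_add_right (hhi i) r
    · exact Nat.add_le_add_right (hhi i) r
    · show (if lo i + r ≤ hi i then hi i else lo i + r) ≤ M + r
      split_ifs
      · exact (hhi i).trans (Nat.le_add_right _ _)
      · exact Nat.add_le_add_right ((hlohi i).trans (hhi i)) r
    · exact (hhi i).trans (Nat.le_add_right _ _)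
  · -- the law
    rw [Fintype.sum_prod_type]
    -- each component's five pieces reassemble its two shifted atoms
    have e : ∀ i, ∑ k : Fin 5,
        (![wAA i, wAB i, wBB i, (if lo i + r ≤ hi i then wBA i else wBA i * (1 - γ i)),
            (if lo i + r ≤ hi i then 0 else wBA i * γ i)] : Fin 5 → ℝ) k *
          TP[(![lo i, lo i, lo i + r, lo i + r, hi i] : Fin 5 → ℕ) k,
             (![hi i, hi i + r, hi i + r, (if lo i + r ≤ hi i then hi i else lo i + r), hi i] : Fin 5 → ℕ) k,
             (![γ i, γ i, γ i, (if lo i + r ≤ hi i then γ i else 1), 1] : Fin 5 → ℝ) k, h]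
        = lam i * (γ i * (1 - θ (hi i)) * (if h = hi i then (1 : ℝ) else 0)
            + (1 - γ i) * (1 - θ (lo i)) * (if h = lo i then (1 : ℝ) else 0)
            + γ i * θ (hi i) * (if h = hi i + r then (1 : ℝ) else 0)
            + (1 - γ i) * θ (lo i) * (if h = lo i + r then (1 : ℝ) else 0)) := by
      intro i
      rw [Fin.sum_univ_five]
      simp only [Matrix.cons_val_zero, Matrix.cons_val_one, Matrix.head_cons, Matrix.cons_val_two, Matrix.tail_cons,
        Matrix.cons_val_three, Matrix.cons_val_four]
      split_ifs <;> · simp only [hwAA, hwAB, hwBB, hwBA]; ring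
    simp_rw [e]
    -- the two sides, atom by atom
    have eA : μ₁ h = ∑ i, lam i * (γ i * (1 - θ (hi i)) * (if h = hi i then (1 : ℝ) else 0)
        + (1 - γ i) * (1 - θ (lo i)) * (if h = lo i then (1 : ℝ) else 0)) := by
      rw [← hθA h, hlaw h, Finset.mul_sum]
      refine Finset.sum_congr rfl fun i _ => ?_
      have e1 : (1 - θ h) * (if h = hi i then (1 : ℝ) else 0) = (1 - θ (hi i)) * (if h = hi i then (1 : ℝ) else 0) :=
        mul_indicator_eq (fun t => 1 - θ t) h (hi i)
      have e2 : (1 - θ h) * (if h = lo i then (1 : ℝ) else 0) = (1 - θ (lo i)) * (if h = lo i then (1 : ℝ) else 0) :=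
        mul_indicator_eq (fun t => 1 - θ t) h (lo i)
      calc (1 - θ h) * (lam i * TP[lo i, hi i, γ i, h])
          = lam i * (γ i * ((1 - θ h) * (if h = hi i then (1 : ℝ) else 0))
              + (1 - γ i) * ((1 - θ h) * (if h = lo i then (1 : ℝ) else 0))) := by ring
        _ = _ := by rw [e1, e2]; ring
    have eB : (if r ≤ h then μ₂ (h - r) else 0) = ∑ i, lam i * (γ i * θ (hi i) * (if h = hi i + r then (1 : ℝ) else 0)
        + (1 - γ i) * θ (lo i) * (if h = lo i + r then (1 : ℝ) else 0)) := by
      by_cases hr : r ≤ h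
      · rw [if_pos hr, ← hθB (h - r), hlaw (h - r), Finset.mul_sum]
        refine Finset.sum_congr rfl fun i _ => ?_
        have e1 : θ (h - r) * (if h - r = hi i then (1 : ℝ) else 0) = θ (hi i) * (if h = hi i + r then (1 : ℝ) else 0) := by
          by_cases hc : h - r = hi i
          · rw [if_pos hc, if_pos (by omega), hc]
          · rw [if_neg hc, if_neg (by omega), mul_zero, mul_zero]
        have e2 : θ (h - r) * (if h - r = lo i then (1 : ℝ) else 0) = θ (lo i) * (if h = lo i + r then (1 : ℝ) else 0) := by
          by_cases hc : h - r = lo i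
          · rw [if_pos hc, if_pos (by omega), hc]
          · rw [if_neg hc, if_neg (by omega), mul_zero, mul_zero]
        calc θ (h - r) * (lam i * TP[lo i, hi i, γ i, h - r])
            = lam i * (γ i * (θ (h - r) * (if h - r = hi i then (1 : ℝ) else 0))
                + (1 - γ i) * (θ (h - r) * (if h - r = lo i then (1 : ℝ) else 0))) := by ring
          _ = _ := by rw [e1, e2]; ring
      · rw [if_neg hr]
        symm
        refine Finset.sum_eq_zero fun i _ => ?_
        rw [if_neg (by omega), if_neg (by omega)]; ring
    rw [eA, eB, ← Finset.sum_add_distrib]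
    exact Finset.sum_congr rfl fun i _ => by ring
  · -- validity
    rintro ⟨i, k⟩ hp
    have hl0 : (0 : ℝ) ≤ lo i := Nat.cast_nonneg _
    have hr0 : (0 : ℝ) ≤ r := Nat.cast_nonneg _
    have hlh : (lo i : ℝ) ≤ hi i := by exact_mod_cast hlohi i
    fin_cases k
    · -- AA
      have hl : 0 < lam i := hpos i _ _ (by linarith [hθ1 (lo i)]) (by linarith [hθ0 (lo i)]) (by linarith [hθ1 (hi i)])
        (by linarith [hθ0 (hi i)]) hp
      exact hval i hl
    · -- AB : {lo, hi + r}
      have hl : 0 < lam i := hpos i _ _ (by linarith [hθ1 (lo i)]) (by linarith [hθ0 (lo i)]) (hθ0 (hi i)) (hθ1 (hi i)) hp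
      obtain ⟨hxγ, hcr⟩ := hval i hl
      refine ⟨hxγ, ?_⟩
      show T ≤ 2 * ((lo i : ℕ) : ℝ) + (((hi i + r : ℕ) : ℝ) - (lo i : ℕ)) * γ i
      push_cast
      nlinarith [(hγ i).1]
    · -- BB : {lo + r, hi + r}
      have hl : 0 < lam i := hpos i _ _ (hθ0 (lo i)) (hθ1 (lo i)) (hθ0 (hi i)) (hθ1 (hi i)) hp
      obtain ⟨hxγ, hcr⟩ := hval i hl
      refine ⟨hxγ, ?_⟩
      show T ≤ 2 * ((lo i + r : ℕ) : ℝ) + (((hi i + r : ℕ) : ℝ) - ((lo i + r : ℕ) : ℝ)) * γ i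
      push_cast
      nlinarith [(hγ i).1]
    · -- BA : the pair {lo + r, hi}, or its low point
      change 0 < (if lo i + r ≤ hi i then wBA i else wBA i * (1 - γ i)) at hp
      show x ≤ (if lo i + r ≤ hi i then γ i else 1) ∧
        T ≤ 2 * ((lo i + r : ℕ) : ℝ) + (((if lo i + r ≤ hi i then hi i else lo i + r : ℕ) : ℝ) - ((lo i + r : ℕ) : ℝ))
          * (if lo i + r ≤ hi i then γ i else 1)
      by_cases hc : lo i + r ≤ hi i
      · rw [if_pos hc] at hp ⊢; rw [if_pos hc]
        have hl : 0 < lam i := hpos i _ _ (hθ0 (lo i)) (hθ1 (lo i)) (by linarith [hθ1 (hi i)]) (by linarith [hθ0 (hi i)]) hp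
        obtain ⟨hxγ, hcr⟩ := hval i hl
        refine ⟨hxγ, ?_⟩
        have hk : 0 ≤ (r : ℝ) * (2 - γ i) := mul_nonneg hr0 (by linarith [(hγ i).2])
        push_cast
        nlinarith [hk]
      · rw [if_neg hc] at hp ⊢; rw [if_neg hc]
        have hp' : 0 < wBA i := by
          rcases (hwBA0 i).eq_or_lt with hz | hz
          · rw [← hz, zero_mul] at hp; exact absurd hp (lt_irrefl 0)
          · exact hz
        have hl : 0 < lam i := hpos i _ _ (hθ0 (lo i)) (hθ1 (lo i)) (by linarith [hθ1 (hi i)]) (by linarith [hθ0 (hi i)]) hp'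
        obtain ⟨_, hcr⟩ := hval i hl
        refine ⟨hx1, ?_⟩
        have hgt : (hi i : ℝ) + 1 ≤ (lo i : ℝ) + r := by exact_mod_cast (by omega : hi i + 1 ≤ lo i + r)
        have hk : ((hi i : ℝ) - lo i) * γ i ≤ (hi i : ℝ) - lo i := mul_le_of_le_one_right (by linarith) (hγ i).2
        push_cast
        nlinarith [hk, hgt]
    · -- BA : its high point
      change 0 < (if lo i + r ≤ hi i then (0 : ℝ) else wBA i * γ i) at hp
      show x ≤ 1 ∧ T ≤ 2 * ((hi i : ℕ) : ℝ) + (((hi i : ℕ) : ℝ) - (hi i : ℕ)) * 1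
      by_cases hc : lo i + r ≤ hi i
      · rw [if_pos hc] at hp; exact absurd hp (lt_irrefl 0)
      · rw [if_neg hc] at hp
        have hp' : 0 < wBA i := by
          rcases (hwBA0 i).eq_or_lt with hz | hz
          · rw [← hz, zero_mul] at hp; exact absurd hp (lt_irrefl 0)
          · exact hz
        have hl : 0 < lam i := hpos i _ _ (hθ0 (lo i)) (hθ1 (lo i)) (by linarith [hθ1 (hi i)]) (by linarith [hθ0 (hi i)]) hp'
        obtain ⟨_, hcr⟩ := hval i hl
        refine ⟨hx1, ?_⟩
        have hk : ((hi i : ℝ) - lo i) * γ i ≤ (hi i : ℝ) - lo i := mul_le_of_le_one_right (by linarith) (hγ i).2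
        nlinarith [hk]

end LawDec
end Quant
end Summit.CriticalPhenomena.PercolationContinuityZ3.Theorems
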